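import Summits.QuantumFields.YangMills.Theorems.BalabanUVNodesPortS1ClassTwins
import Summits.QuantumFields.YangMills.Theorems.BalabanUVNodesPortS1LZdetAssembly

/-!
# NODE O port PT-A — THE GAUSSIAN HALF OF `log Z^{(k)}` ON PRINT's ε₀-CLASS, AT FIXED CARRIERS (★★★ director-ym №627a (1′), g11 docket 1, part C): the class twin of ✓`…LZdetGerm` ∕
# ✓`…LZdetPack` ∕ ✓`…LZdetAssembly` with the (f′) row AT EVERY POINT of `InRegClass … ε₀`, the class-only inputs DISPLAYED row by row — (P2) at class points, (P5) at class points, the nesting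
# `InRegClass → CutsInUc` — and the resolvent identity (g1) taken POINTWISE from the hand's collector (✓`sum_g3cEG`), re-exported here beside `G3CPiecesAt`

Cell `ym-nodeO-ideate`, porter seat PT-A-1 (gen 11); `--kind proof --supports stmt-QuantumFields-27930 --as helper`; count-neutral.  [I] = [Balaban1987RG1]; [16] = [Balaban1985UV3];
[15] = [Balaban1985Variational].

WHY.  v3.7's `stub_LZhalfReg` wants the LZ residue with (f′) ON the class; `phiLZ = phiLZjac + phiLZdet`; the δ-Jacobian summand is a THEOREM on the class (✓`…LZjacReg`, part B).  For the
Gaussian summand the germ files (gens 7–8) filter five `∀ᶠ B` inputs; on the class: the letter `RecordB0BlockInvertible` at `V^{(k)}_{ax}(W_B)` is a THEOREM (✓`…ClassTwins`), the other four are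
the located class rows (this seat's nodeO line): (P2)-class (✓`ClassP2Reg`), (P5)-class, NEST-class (`CutsInUc`), and (g1) — the last NOT a new letter: the hand's resummed pieces satisfy (g1) at
EVERY pair (✓`sum_g3cEG`), the letter `G3CPiecesAt` merely typed it as a germ; the companion file ✓`…PortS1G3CPointwise` re-inhabits the pointwise edition, consumed here as the hypothesis `hg1pt`.
* §1 ★ `residueOnRegAtW_of_piecesJ` — ε₀-class packaging (✓`residueAtW_of_piecesJ` with the uncut identity at every class point).
* §2 ★★ `phiLZdet_eq_sum_lzdetPiece_at` — [16] (61)∕(63) on `[0, R]` AT ONE chart point `B`, all inputs pointwise at `B` and at the base point `0` (the germ theorem's inner `key`, exported).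
* (companion file ✓`…PortS1G3CPointwise`: `g3cPiecesAt_pointwise` — `G3CAtRecordL`'s conclusion ∧ (g1) FOR EVERY PAIR, the hand's construction verbatim.)
* §3 ★★★ `lzdetResidueOnReg_of_carriers` — at fixed carriers with the P0-ℂ body, G3C pieces with pointwise (g1), the power member's integer twin, ⁸'s TokE token at `ε₁`, the class radius
  `ε₀ ≤ 1∕(53581824·L⁶)`, `2ε₀ ≤ ε₁`, and the three class rows DISPLAYED at `ε₀`: `∃ Ψ Ew, Ψ.ResidueOnRegAtW … ε₀ E₁ κ (phiLZdet …)` with the germ's constants `E₁ = 2·13·4⁴·(R·Bc + 12(L·Mc)⁴)`,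
  `κ = min κt (δ₀∕2) − 2`.

HONEST FRAMING.  Class twin of landed bookkeeping; the three class rows are HYPOTHESES here (letters ✓`ClassP2Reg`, `ClassP5Reg`, `ClassNestsUc` — asserted for nothing, inhabited nowhere; the
letter-level walk is part D); nothing of Bałaban's RG estimates asserted, ported or discharged; `stub_P0C` ∕ `stub_LZhalfReg` ∕ `stub_FEstepReg` OPEN; ⟨27930⟩ OPEN 1∕4 · no claim; NODE O 0∕1;
COUNT 8∕28 · K 1∕4 UNMOVED; finite `𝕋⁴_{L^K}` at fixed ε — NOT continuum ∕ OS; **the Yang–Mills mass gap (Clay) is NOT proved by any of this.**  No `sorry`, no `def`, no `instance`; standard axioms.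
-/

noncomputable section

open scoped BigOperators Matrix.Norms.L2Operator Topology Matrix Classical
open Filter Finset

namespace Summit.QuantumFields.YangMills.Theorems.BalabanUVNodesPortS1

open Summit.QuantumFields.YangMills.Theorems.K0RecordFormatNames
open Literature.MathematicalPhysics.QuantumFieldTheory.Balaban1983to89
open Literature.MathematicalPhysics.QuantumFieldTheory.Balaban1983to89.Node00
open Literature.MathematicalPhysics.QuantumFieldTheory.Balaban1983to89.T4Continuum (T4Family)
open Literature.MathematicalPhysics.QuantumFieldTheory.Balaban1983to89.TreeLengthTorus
open Literature.MathematicalPhysics.QuantumFieldTheory.Balaban1983to89.B12TreeDecay (K₀ kappa₀ K₀_pos kappa₀_nonneg)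

variable (F : T4Family)

/-! ## §1  ε₀-class packaging: pieces + the uncut identity on the class ⟹ `ResidueOnRegAtW` -/

/-- ★ **TORUS-LEVEL PIECES + THE UNCUT IDENTITY ON THE CLASS ⟹ THE ε₀-CLASS RESIDUE** (✓`residueAtW_of_piecesJ`, class edition): rows (a)(b) on the record spaces, (c) locality, (d) invariance,
off-wrap pieces = pull-back pieces of ONE `Ψ`, and `Φ n B = Σ_X E n X (recordPairJ … B)` AT EVERY `B` with `InRegClass … ε₀ … B` give `Ψ.ResidueOnRegAtW … ε₀ E₀ κ Φ` (locality cuts the pair).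
[cite: Balaban1987RG1, (1.6)–(1.9) p.261, (1.18)–(1.19) p.263, (1.21) p.264, (1.1)–(1.2) p.260; Balaban1985UV3, (63) p.272] -/
theorem residueOnRegAtW_of_piecesJ (Mc k : ℕ) (a₀ ε₂₉ α₀ α₁ ε₀ E₀ κ : ℝ) (Ψ : IntLocalFormula (F.L ^ (k + 1) * Mc)) (E : TorusPieces F Mc k)
    (Φ : (n : ℕ) → recordW F a₀ ε₂₉ k (recordK₀ F Mc k + n) → ℂ)
    (hEΨ : ∀ n (X : (recordDomSys F Mc k (recordK₀ F Mc k + n)).Dom), X ∉ recordWrapCtr F Mc k (recordK₀ F Mc k + n) →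
      ∀ φ, E n X φ = Ψ.Ψ.piece F Mc k (recordK₀ F Mc k + n) X φ)
    (hEA : ∀ n (X : (recordDomSys F Mc k (recordK₀ F Mc k + n)).Dom) (φ : Sect2.CPair (F.P (recordK₀ F Mc k + n)) (MatA 2)),
      encodeCfg F (recordK₀ F Mc k + n) φ ∈ recordUc F Mc k α₀ α₁ (recordK₀ F Mc k + n) X → AnalyticAt ℂ (E n X) φ)
    (hEB : ∀ n (X : (recordDomSys F Mc k (recordK₀ F Mc k + n)).Dom) (φ : Sect2.CPair (F.P (recordK₀ F Mc k + n)) (MatA 2)),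
      encodeCfg F (recordK₀ F Mc k + n) φ ∈ recordUc F Mc k α₀ α₁ (recordK₀ F Mc k + n) X →
        ‖E n X φ‖ ≤ E₀ * Real.exp (-κ * (recordDomSys F Mc k (recordK₀ F Mc k + n)).dj X))
    (hEL : ∀ n (X : (recordDomSys F Mc k (recordK₀ F Mc k + n)).Dom) (φ ψ : Sect2.CPair (F.P (recordK₀ F Mc k + n)) (MatA 2)),
      Sect2.agreeOnSet (Sect2.domSites (F.P (recordK₀ F Mc k + n)) Mc (k + 1) X) φ ψ → E n X φ = E n X ψ)
    (hEG : ∀ n (X : (recordDomSys F Mc k (recordK₀ F Mc k + n)).Dom) (u : recordGaugeGrp F (recordK₀ F Mc k + n)) φ, E n X (Sect2.cAct u.1 φ) = E n X φ)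
    (hrepJ : ∀ n (B : recordW F a₀ ε₂₉ k (recordK₀ F Mc k + n)), InRegClass F Mc k ε₀ a₀ ε₂₉ n B →
      letI θ := thetaFill F a₀ ε₂₉
      Φ n B = ∑ X : (recordDomSys F Mc k (recordK₀ F Mc k + n)).Dom, E n X (recordPairJ F θ k (recordK₀ F Mc k + n) B)) :
    Ψ.ResidueOnRegAtW F Mc k E a₀ ε₂₉ α₀ α₁ ε₀ E₀ κ Φ := by
  refine ⟨fun n X hX φ hφ => ?_, fun n X hX φ hφ => ?_, fun n X _ φ hφ => hEA n X φ hφ, fun n X _ φ hφ => hEB n X φ hφ,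
    fun n X _ φ ψ hag => hEL n X φ ψ hag, fun n X _ u φ => hEG n X u φ, fun n B hB => ?_⟩
  · have hfun : (fun ψ => Ψ.Ψ.piece F Mc k (recordK₀ F Mc k + n) X ψ) = E n X := funext fun ψ => (hEΨ n X hX ψ).symm
    rw [hfun]
    exact hEA n X φ hφ
  · rw [← hEΨ n X hX φ]
    exact hEB n X φ hφ
  · rw [hrepJ n B hB]
    refine Finset.sum_congr rfl fun X _ => ?_
    have hcut : E n X (recordPairJ F (thetaFill F a₀ ε₂₉) k (recordK₀ F Mc k + n) B) = E n X (pairCutTorusAt F a₀ ε₂₉ Mc k (recordK₀ F Mc k + n) X B) :=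
      hEL n X _ _ (agreeOnSet_pairCutTorusAt a₀ ε₂₉ Mc k (recordK₀ F Mc k + n) X B)
    rw [hcut]
    by_cases hX : X ∈ recordWrapCtr F Mc k (recordK₀ F Mc k + n)
    · rw [if_pos hX]
    · rw [if_neg hX, pairCutAt_eq_pullPair_pairCutTorusAt]
      exact hEΨ n X hX _

/-! ## §2  ★★ The Gaussian bracket is the sum of its localized pieces AT ONE chart point (all inputs pointwise) -/

/-- ★★ **`phiLZdet n B = Σ_X lzdetPiece … X (recordPairJ … B)` AT ONE CHART POINT `B`**, from data AT `B` and AT the base point `0`: the letter `RecordB0BlockInvertible` at `V^{(k)}_{ax}(W_B)`, (P2)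
(agreement of the non-b₀ block of `TC (recordPairJ …)` with `T := recordPreckLoc … (portVkAx …) …`) at both, `PosDef T` + the form bound `γ₁` at both, (P4-sum), (P4-supp) through the cube map,
the operator-norm decay of the non-b₀ blocks of the pieces at both pairs, (g1) at both pairs and x-continuity of the resolvent pieces on `[0, R]` at both pairs; constants as in the germ theorem.
(The germ theorem ✓`eventually_phiLZdet_eq_sum_lzdetPiece`'s inner `key`, exported pointwise.) [cite: Balaban1985UV3, (61)∕(63) pp.271–272, (23)–(25) p.262; Balaban1987RG1, (2.11)–(2.14) pp.267–268, (1.7) p.261] -/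
theorem phiLZdet_eq_sum_lzdetPiece_at (Mc : ℕ) (a₀ ε₂₉ : ℝ) (k n : ℕ) (B : recordW F a₀ ε₂₉ k (recordK₀ F Mc k + n))
    (TC : Sect2.CPair (F.P (recordK₀ F Mc k + n)) (MatA 2) → FluctIdx F k (recordK₀ F Mc k + n) → FluctIdx F k (recordK₀ F Mc k + n) → ℂ)
    (TY : (recordDomSys F Mc k (recordK₀ F Mc k + n)).Dom → Sect2.CPair (F.P (recordK₀ F Mc k + n)) (MatA 2) →
        FluctIdx F k (recordK₀ F Mc k + n) → FluctIdx F k (recordK₀ F Mc k + n) → ℂ)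
    (EG : ℝ → (recordDomSys F Mc k (recordK₀ F Mc k + n)).Dom → Sect2.CPair (F.P (recordK₀ F Mc k + n)) (MatA 2) → ℂ)
    (cube : NonB0Idx F k (recordK₀ F Mc k + n) → TPt (F.P (recordK₀ F Mc k + n)).d (Sect2.domCount (F.P (recordK₀ F Mc k + n)) Mc (k + 1)))
    {γ₁ c₀ δ₀ R : ℝ} (hγ₁ : 0 < γ₁) (hc₀ : 0 ≤ c₀)
    (hδ : kappa₀ (4 * 2 ^ (F.P (recordK₀ F Mc k + n)).d) (2 * (F.P (recordK₀ F Mc k + n)).d) ≤ δ₀ / 2 - 1) (hR : 2 * γ₁ ≤ R)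
    (hRc : 2 * (c₀ * (4 * 2 ^ (F.P (recordK₀ F Mc k + n)).d * K₀ (4 * 2 ^ (F.P (recordK₀ F Mc k + n)).d) (2 * (F.P (recordK₀ F Mc k + n)).d)) * Real.exp δ₀) ≤ R)
    -- the letter at `V_B`
    (hA : RecordB0BlockInvertible F k (recordK₀ F Mc k + n) (portVkAx F a₀ ε₂₉ k (recordK₀ F Mc k + n) B))
    -- (P2) and (P5) at `B` and at `0`
    (hP2 : ∀ B' : recordW F a₀ ε₂₉ k (recordK₀ F Mc k + n),
      letI θ := thetaFill F a₀ ε₂₉; letI := θ.instVβ₁; letI := θ.instVβ₂; letI := θ.instιβ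
      (B' = B ∨ B' = 0) → ∀ i j : NonB0Idx F k (recordK₀ F Mc k + n),
        TC (recordPairJ F θ k (recordK₀ F Mc k + n) B') i.1 j.1 =
          ((recordPreckLoc F k (recordK₀ F Mc k + n) a₀ (portVkAx F a₀ ε₂₉ k (recordK₀ F Mc k + n) B')
            (hopLinGraph F k (recordK₀ F Mc k + n) (portVkAx F a₀ ε₂₉ k (recordK₀ F Mc k + n) B')) i j : ℝ) : ℂ))
    (hP5 : ∀ B' : recordW F a₀ ε₂₉ k (recordK₀ F Mc k + n),
      letI θ := thetaFill F a₀ ε₂₉; letI := θ.instVβ₁; letI := θ.instVβ₂; letI := θ.instιβ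
      (B' = B ∨ B' = 0) →
        (recordPreckLoc F k (recordK₀ F Mc k + n) a₀ (portVkAx F a₀ ε₂₉ k (recordK₀ F Mc k + n) B')
            (hopLinGraph F k (recordK₀ F Mc k + n) (portVkAx F a₀ ε₂₉ k (recordK₀ F Mc k + n) B'))).PosDef ∧
        ∀ v : NonB0Idx F k (recordK₀ F Mc k + n) → ℝ,
            dotProduct v (Matrix.mulVec (recordPreckLoc F k (recordK₀ F Mc k + n) a₀ (portVkAx F a₀ ε₂₉ k (recordK₀ F Mc k + n) B')
                (hopLinGraph F k (recordK₀ F Mc k + n) (portVkAx F a₀ ε₂₉ k (recordK₀ F Mc k + n) B'))) v) ≤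
              γ₁ * dotProduct v v)
    -- (P4-sum) everywhere; (P4-supp) on the non-b₀ blocks through the cube map
    (hsum : ∀ φ i j, TC φ i j = ∑ Y, TY Y φ i j)
    (hsupp : ∀ Y φ (s s' : NonB0Idx F k (recordK₀ F Mc k + n)),
      (cube s ∉ (Y.1 : Finset (TPt (F.P (recordK₀ F Mc k + n)).d (Sect2.domCount (F.P (recordK₀ F Mc k + n)) Mc (k + 1)))) ∨
        cube s' ∉ (Y.1 : Finset (TPt (F.P (recordK₀ F Mc k + n)).d (Sect2.domCount (F.P (recordK₀ F Mc k + n)) Mc (k + 1))))) → TY Y φ s.1 s'.1 = 0)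
    -- operator-norm decay of the non-b₀ blocks at the two pairs
    (hSchur : ∀ B' : recordW F a₀ ε₂₉ k (recordK₀ F Mc k + n),
      letI θ := thetaFill F a₀ ε₂₉; letI := θ.instVβ₁; letI := θ.instVβ₂; letI := θ.instιβ
      (B' = B ∨ B' = 0) → ∀ Y,
        ‖nonB0Block F k (recordK₀ F Mc k + n) (TY Y (recordPairJ F θ k (recordK₀ F Mc k + n) B'))‖ ≤
          c₀ * Real.exp (-(δ₀ * torusTreeLen (Y.1 : Finset (TPt (F.P (recordK₀ F Mc k + n)).d (Sect2.domCount (F.P (recordK₀ F Mc k + n)) Mc (k + 1)))))))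
    -- (g1) at every pair, x-continuity at the two pairs
    (hg1 : ∀ φ (x : ℝ), 0 ≤ x →
      ∑ X, EG x X φ = (((x : ℂ) • (1 : Matrix (NonB0Idx F k (recordK₀ F Mc k + n)) (NonB0Idx F k (recordK₀ F Mc k + n)) ℂ) +
        nonB0Block F k (recordK₀ F Mc k + n) (TC φ))⁻¹).trace)
    (hcont : ∀ B' : recordW F a₀ ε₂₉ k (recordK₀ F Mc k + n),
      letI θ := thetaFill F a₀ ε₂₉; letI := θ.instVβ₁; letI := θ.instVβ₂; letI := θ.instιβ
      (B' = B ∨ B' = 0) → ∀ X, ContinuousOn (fun x : ℝ => EG x X (recordPairJ F θ k (recordK₀ F Mc k + n) B')) (Set.Icc 0 R)) :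
    letI θ := thetaFill F a₀ ε₂₉; letI := θ.instVβ₁; letI := θ.instVβ₂; letI := θ.instιβ
    phiLZdet F Mc a₀ ε₂₉ k n B = ∑ X, lzdetPiece F Mc k (recordK₀ F Mc k + n) TY EG R X (recordPairJ F θ k (recordK₀ F Mc k + n) B) := by
  letI θ := thetaFill F a₀ ε₂₉; letI := θ.instVβ₁; letI := θ.instVβ₂; letI := θ.instιβ
  have hpair₀ : recordPairJ F θ k (recordK₀ F Mc k + n) (0 : recordW F a₀ ε₂₉ k (recordK₀ F Mc k + n)) = unitCPair F (recordK₀ F Mc k + n) := recordPairJ_zero F a₀ ε₂₉ Mc k n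
  -- the pointwise identity at a configuration with the data
  have key : ∀ (φ : Sect2.CPair (F.P (recordK₀ F Mc k + n)) (MatA 2)) (T : Matrix (NonB0Idx F k (recordK₀ F Mc k + n)) (NonB0Idx F k (recordK₀ F Mc k + n)) ℝ), T.PosDef →
      (∀ v, dotProduct v (T.mulVec v) ≤ γ₁ * dotProduct v v) →
      (∀ i j : NonB0Idx F k (recordK₀ F Mc k + n), TC φ i.1 j.1 = ((T i j : ℝ) : ℂ)) →
      (∀ Y, ‖nonB0Block F k (recordK₀ F Mc k + n) (TY Y φ)‖ ≤ c₀ * Real.exp (-(δ₀ * torusTreeLen (Y.1 : Finset (TPt (F.P (recordK₀ F Mc k + n)).d (Sect2.domCount (F.P (recordK₀ F Mc k + n)) Mc (k + 1))))))) →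
      (∀ x : ℝ, 0 ≤ x → ∑ X, EG x X φ = (((x : ℂ) • (1 : Matrix (NonB0Idx F k (recordK₀ F Mc k + n)) (NonB0Idx F k (recordK₀ F Mc k + n)) ℂ) + nonB0Block F k (recordK₀ F Mc k + n) (TC φ))⁻¹).trace) →
      (∀ X, ContinuousOn (fun x : ℝ => EG x X φ) (Set.Icc 0 R)) →
      (((-(1 / 2) * Real.log T.det + (1 / 2) * (Fintype.card (NonB0Idx F k (recordK₀ F Mc k + n)) : ℝ) * Real.log R : ℝ)) : ℂ)
        = ∑ X, lzdetGPiece F Mc k (recordK₀ F Mc k + n) TY EG R X φ := by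
    intro φ T hT hform h2 hS hg hc
    have hTC : T.map (Complex.ofReal) = ∑ Y, nonB0Block F k (recordK₀ F Mc k + n) (TY Y φ) :=
      map_ofReal_eq_sum_nonB0Block F Mc k (recordK₀ F Mc k + n) T (TC φ) (fun Y => TY Y φ) h2 (hsum φ)
    have hblk : nonB0Block F k (recordK₀ F Mc k + n) (TC φ) = ∑ Y, nonB0Block F k (recordK₀ F Mc k + n) (TY Y φ) := by
      rw [← nonB0Block_sum]; congr 1; funext i j; exact hsum φ i j
    have hg' : ∀ x : ℝ, 0 ≤ x → ∑ X, EG x X φ = (((x : ℂ) • (1 : Matrix (NonB0Idx F k (recordK₀ F Mc k + n)) (NonB0Idx F k (recordK₀ F Mc k + n)) ℂ) + ∑ Y, nonB0Block F k (recordK₀ F Mc k + n) (TY Y φ))⁻¹).trace := by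
      intro x hx; rw [hg x hx, hblk]
    exact logDet63_localized_at (S := NonB0Idx F k (recordK₀ F Mc k + n)) cube (fun Y => nonB0Block F k (recordK₀ F Mc k + n) (TY Y φ)) (fun x X => EG x X φ) hT hγ₁ hform hR hTC
      (fun Y s s' h => by simp only [nonB0Block, Matrix.of_apply]; exact hsupp Y φ s s' h) hc₀ hδ hS hRc hg' hc
  have hP5B := hP5 B (Or.inl rfl)
  have hP5₀ := hP5 0 (Or.inr rfl)
  have hdetB := phiLZdet_eq_logDet₀ F Mc a₀ ε₂₉ k n B hA hP5B.1 hP5₀.1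
  rw [show (thetaFill F a₀ ε₂₉).εbg = a₀ from rfl] at hdetB
  have hB := key _ _ hP5B.1 hP5B.2 (hP2 B (Or.inl rfl)) (hSchur B (Or.inl rfl)) (hg1 _) (hcont B (Or.inl rfl))
  have h0 := key _ _ hP5₀.1 hP5₀.2 (hP2 0 (Or.inr rfl)) (hSchur 0 (Or.inr rfl)) (hg1 _) (hcont 0 (Or.inr rfl))
  rw [hpair₀] at h0
  rw [hdetB]
  -- −½(log det T(B) − log det T(0)) = [−½ log det T(B) + c] − [−½ log det T(0) + c]
  have hsplit : ∀ (A A₀ c : ℝ), ((-(1 / 2 : ℝ) * (A - A₀) : ℝ) : ℂ) = (((-(1 / 2) * A + c : ℝ)) : ℂ) - (((-(1 / 2) * A₀ + c : ℝ)) : ℂ) := by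
    intro A A₀ c; push_cast; ring
  rw [hsplit _ _ ((1 / 2) * (Fintype.card (NonB0Idx F k (recordK₀ F Mc k + n)) : ℝ) * Real.log R), hB, h0, ← sum_sub_distrib]
  simp only [lzdetPiece]

/-! ## §3  ★★★ The ε₀-class residue of `phiLZdet` at fixed carriers -/

/-- ★★★ **THE GAUSSIAN SUB-HALF ON THE ε₀-CLASS AT FIXED CARRIERS.**  As ✓`lzdetResidue_of_carriers` (same constants `κ₀(64,8) ≤ δ₀∕2 − 1`, `2γ₁ ≤ R`, `16c₀·(64K₀)·e^{δ₀} ≤ R`, same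
`E₁ = 2·13·4⁴·(R·Bc + 12(L·Mc)⁴)`, `κ = min κt (δ₀∕2) − 2`), WITHOUT the analyticity token, WITH: the class radius `0 < ε₀ ≤ 1∕(53581824·L⁶)`, `2ε₀ ≤ ε₁` (TokE radius), (g1) pointwise, and the three
class rows at `ε₀` DISPLAYED — (P2) at every class point, (P5) (`PosDef` + the `γ₁` form bound) at every class point, `CutsInUc … α₀ α₁` at every class point.  Conclusion:
`∃ Ψ Ew, Ψ.ResidueOnRegAtW F Mc k Ew a₀ ε₂₉ α₀ α₁ ε₀ E₁ κ (phiLZdet …)` — rows (a)–(e) and the (63) identity AT EVERY POINT of `InRegClass … ε₀`.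
[cite: Balaban1985UV3, (63) p.272, (23)–(25) p.262; Balaban1987RG1, (1.6)–(1.9) p.261, (1.18)–(1.19) p.263, (1.21) p.264, (2.11)–(2.14) pp.267–268, (1.1)–(1.2) p.260, p.263 L5–13;
Balaban1985Variational, Thm 1 p.279, Prop. 9 p.309] -/
theorem lzdetResidueOnReg_of_carriers {Mc : ℕ} (hMc : McGuard F Mc) (k : ℕ) {a₀ ε₂₉ α₀ α₁ c₀ γ₀ γ₁ δ₀ κt Bc R ε₀ ε₁ : ℝ}
    (ha₀ : 0 < a₀) (hα₀ : 0 < α₀) (hα₁ : 0 < α₁) (hc₀ : 0 < c₀) (hγ₁ : 0 < γ₁) (hBc : 0 ≤ Bc) (hR : 0 < R) (hR₁ : 2 * γ₁ ≤ R)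
    (hδ : kappa₀ (4 * 2 ^ 4) (2 * 4) ≤ δ₀ / 2 - 1)
    (hRc : 2 * ((2 * c₀) * (4 * 2 ^ 4 * K₀ (4 * 2 ^ 4) (2 * 4)) * Real.exp δ₀) ≤ R)
    (hε₀ : 0 < ε₀) (hε₀c : ε₀ ≤ 1 / (53581824 * (F.L : ℝ) ^ 6)) (hε₀₁ : 2 * ε₀ ≤ ε₁)
    (hTokE : ∀ (n : ℕ) (V : GaugeField (F.P (recordK₀ F Mc k + n)) (k + 1) (SU 2)), PlaqSmall ε₁ V →
      UkExists F 2 (recordK₀ F Mc k + n) (k + 1) a₀ V ∧ UniqueUkOrbit F 2 (recordK₀ F Mc k + n) (k + 1) a₀ V)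
    (TC : (n : ℕ) → Sect2.CPair (F.P (recordK₀ F Mc k + n)) (MatA 2) → FluctIdx F k (recordK₀ F Mc k + n) → FluctIdx F k (recordK₀ F Mc k + n) → ℂ)
    (TY : (n : ℕ) → (recordDomSys F Mc k (recordK₀ F Mc k + n)).Dom → Sect2.CPair (F.P (recordK₀ F Mc k + n)) (MatA 2) →
        FluctIdx F k (recordK₀ F Mc k + n) → FluctIdx F k (recordK₀ F Mc k + n) → ℂ)
    (TZY : Finset (Fin 4 → ℤ) → IntBondCfg → ((Fin 4 → ℤ) × Fin 4) × Fin 3 → ((Fin 4 → ℤ) × Fin 4) × Fin 3 → ℂ)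
    (AdM : (n : ℕ) → (Site (F.P (recordK₀ F Mc k + n)) 0 → (MatA 2)ˣ) → Matrix (FluctIdx F k (recordK₀ F Mc k + n)) (FluctIdx F k (recordK₀ F Mc k + n)) ℂ)
    (AdZ : ((Fin 4 → ℤ) → (MatA 2)ˣ) → (Fin 4 → ℤ) × Fin 4 → Matrix (Fin 3) (Fin 3) ℂ)
    (hP : P0CarrierClauses F a₀ δ₀ c₀ γ₀ γ₁ Mc α₀ α₁ ε₂₉ k TC TY TZY AdM AdZ)
    (EG : ℝ → (n : ℕ) → (recordDomSys F Mc k (recordK₀ F Mc k + n)).Dom → Sect2.CPair (F.P (recordK₀ F Mc k + n)) (MatA 2) → ℂ)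
    (EGZ : ℝ → IntFormula) (hG : G3CPiecesAt F Mc k a₀ ε₂₉ α₀ α₁ κt Bc TC EG EGZ)
    (hg1pt : ∀ (n : ℕ) (x : ℝ), 0 ≤ x → ∀ φ : Sect2.CPair (F.P (recordK₀ F Mc k + n)) (MatA 2),
      ∑ X : (recordDomSys F Mc k (recordK₀ F Mc k + n)).Dom, EG x n X φ =
        (((x : ℂ) • (1 : Matrix (NonB0Idx F k (recordK₀ F Mc k + n)) (NonB0Idx F k (recordK₀ F Mc k + n)) ℂ) +
          Matrix.of (fun i j : NonB0Idx F k (recordK₀ F Mc k + n) => TC n φ i.1 j.1))⁻¹).trace)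
    (ΨP : IntLocalFormula (F.L ^ (k + 1) * Mc))
    (hΨP : ∀ (n : ℕ) (X : (recordDomSys F Mc k (recordK₀ F Mc k + n)).Dom), X ∉ recordWrapCtr F Mc k (recordK₀ F Mc k + n) →
      ∀ φ : Sect2.CPair (F.P (recordK₀ F Mc k + n)) (MatA 2),
        ΨP.Ψ.piece F Mc k (recordK₀ F Mc k + n) X φ =
          powMemberPiece (fun Y : (recordDomSys F Mc k (recordK₀ F Mc k + n)).Dom =>
              (Y.1 : Finset (TPt (F.P (recordK₀ F Mc k + n)).d (Sect2.domCount (F.P (recordK₀ F Mc k + n)) Mc (k + 1)))))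
            (fun Y => nonB0Block F k (recordK₀ F Mc k + n) (TY n Y φ)) R X.1)
    -- the three class rows at `ε₀`, DISPLAYED
    (hP2R : ∀ (n : ℕ) (B : recordW F a₀ ε₂₉ k (recordK₀ F Mc k + n)), InRegClass F Mc k ε₀ a₀ ε₂₉ n B →
      letI θ := thetaFill F a₀ ε₂₉
      ∀ i j : NonB0Idx F k (recordK₀ F Mc k + n),
        TC n (recordPairJ F θ k (recordK₀ F Mc k + n) B) i.1 j.1 =
          ((recordPreckLoc F k (recordK₀ F Mc k + n) a₀ (portVkAx F a₀ ε₂₉ k (recordK₀ F Mc k + n) B)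
            (hopLinGraph F k (recordK₀ F Mc k + n) (portVkAx F a₀ ε₂₉ k (recordK₀ F Mc k + n) B)) i j : ℝ) : ℂ))
    (hP5R : ∀ (n : ℕ) (B : recordW F a₀ ε₂₉ k (recordK₀ F Mc k + n)), InRegClass F Mc k ε₀ a₀ ε₂₉ n B →
      (recordPreckLoc F k (recordK₀ F Mc k + n) a₀ (portVkAx F a₀ ε₂₉ k (recordK₀ F Mc k + n) B)
          (hopLinGraph F k (recordK₀ F Mc k + n) (portVkAx F a₀ ε₂₉ k (recordK₀ F Mc k + n) B))).PosDef ∧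
      ∀ v : NonB0Idx F k (recordK₀ F Mc k + n) → ℝ,
        γ₀ * dotProduct v v ≤
            dotProduct v (Matrix.mulVec (recordPreckLoc F k (recordK₀ F Mc k + n) a₀ (portVkAx F a₀ ε₂₉ k (recordK₀ F Mc k + n) B)
              (hopLinGraph F k (recordK₀ F Mc k + n) (portVkAx F a₀ ε₂₉ k (recordK₀ F Mc k + n) B))) v) ∧
          dotProduct v (Matrix.mulVec (recordPreckLoc F k (recordK₀ F Mc k + n) a₀ (portVkAx F a₀ ε₂₉ k (recordK₀ F Mc k + n) B)
              (hopLinGraph F k (recordK₀ F Mc k + n) (portVkAx F a₀ ε₂₉ k (recordK₀ F Mc k + n) B))) v) ≤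
            γ₁ * dotProduct v v)
    (hNest : ∀ (n : ℕ) (B : recordW F a₀ ε₂₉ k (recordK₀ F Mc k + n)), InRegClass F Mc k ε₀ a₀ ε₂₉ n B → CutsInUc F Mc k α₀ α₁ a₀ ε₂₉ n B) :
    ∃ (Ψ : IntLocalFormula (F.L ^ (k + 1) * Mc)) (Ew : TorusPieces F Mc k),
      Ψ.ResidueOnRegAtW F Mc k Ew a₀ ε₂₉ α₀ α₁ ε₀ (2 * (13 * 4 ^ 4 * (R * Bc + ((3 * 4 * (F.L * Mc) ^ 4 : ℕ) : ℝ)))) (min κt (δ₀ / 2) - 2)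
        (phiLZdet F Mc a₀ ε₂₉ k) := by
  obtain ⟨hZsupp, hZdom, hZloc, hZcov, hZbr, hP2, hP3, hP4sum, hP4supp, hP4loc, hP4an, hP5, hP5c⟩ := hP
  obtain ⟨hg1, hg235, hg4, hg6, hgZ⟩ := hG
  -- constants
  have hc₀' : (0 : ℝ) ≤ c₀ := hc₀.le
  have hKc : 0 ≤ 4 * 2 ^ 4 * K₀ (4 * 2 ^ 4) (2 * 4) := by have := B12TreeDecay.K₀_pos (4 * 2 ^ 4) (2 * 4); positivity
  have hRc₁ : 2 * (c₀ * (4 * 2 ^ 4 * K₀ (4 * 2 ^ 4) (2 * 4)) * Real.exp δ₀) ≤ R := by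
    have : c₀ * (4 * 2 ^ 4 * K₀ (4 * 2 ^ 4) (2 * 4)) * Real.exp δ₀ ≤ (2 * c₀) * (4 * 2 ^ 4 * K₀ (4 * 2 ^ 4) (2 * 4)) * Real.exp δ₀ := by
      nlinarith [mul_nonneg hKc (Real.exp_nonneg δ₀), hc₀']
    linarith
  have hK : ∀ n : ℕ, recordK₀ F Mc k ≤ recordK₀ F Mc k + n := fun n => Nat.le_add_right _ _
  have hdj : ∀ (n : ℕ) (Y : (recordDomSys F Mc k (recordK₀ F Mc k + n)).Dom), (recordDomSys F Mc k (recordK₀ F Mc k + n)).dj Y =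
      torusTreeLen (Y.1 : Finset (TPt (F.P (recordK₀ F Mc k + n)).d (Sect2.domCount (F.P (recordK₀ F Mc k + n)) Mc (k + 1)))) := fun _ _ => rfl
  -- the cube map and the support of the pieces in cube form
  have hsupp : ∀ (n : ℕ) Y φ (s s' : NonB0Idx F k (recordK₀ F Mc k + n)),
      (cubeOfSite F Mc k (recordK₀ F Mc k + n) (blockOf s.1.1.src) ∉ (Y.1 : Finset (TPt (F.P (recordK₀ F Mc k + n)).d (Sect2.domCount (F.P (recordK₀ F Mc k + n)) Mc (k + 1)))) ∨
        cubeOfSite F Mc k (recordK₀ F Mc k + n) (blockOf s'.1.1.src) ∉ (Y.1 : Finset (TPt (F.P (recordK₀ F Mc k + n)).d (Sect2.domCount (F.P (recordK₀ F Mc k + n)) Mc (k + 1))))) →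
        TY n Y φ s.1 s'.1 = 0 :=
    fun n Y φ s s' h => fluct_supp_of_cube hMc (hK n) (hP4supp n) Y φ s s' h
  have hV : ∀ (n : ℕ) q, (univ.filter fun s : NonB0Idx F k (recordK₀ F Mc k + n) => cubeOfSite F Mc k (recordK₀ F Mc k + n) (blockOf s.1.1.src) = q).card ≤ 3 * 4 * (F.L * Mc) ^ 4 :=
    fun n q => card_filter_cube_le hMc (hK n) q
  -- operator-norm decay of the non-b₀ blocks from (P4)'s Schur decay
  have hTYop : ∀ (n : ℕ) (Y : (recordDomSys F Mc k (recordK₀ F Mc k + n)).Dom) φ, encodeCfg F (recordK₀ F Mc k + n) φ ∈ recordUc F Mc k α₀ α₁ (recordK₀ F Mc k + n) Y →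
      ‖nonB0Block F k (recordK₀ F Mc k + n) (TY n Y φ)‖ ≤ c₀ * Real.exp (-(δ₀ * torusTreeLen (Y.1 : Finset (TPt (F.P (recordK₀ F Mc k + n)).d (Sect2.domCount (F.P (recordK₀ F Mc k + n)) Mc (k + 1)))))) := by
    intro n Y φ hφ
    obtain ⟨-, hrow, hcol⟩ := hP4an n Y φ hφ
    rw [← hdj]
    exact norm_nonB0Block_le_of_schur F k _ (TY n Y φ) (by positivity) hrow hcol
  -- the same at a pair that CUTS INTO the record space of `Y` (locality of the pieces)
  have hTYopCut : ∀ (n : ℕ) (B : recordW F a₀ ε₂₉ k (recordK₀ F Mc k + n)), CutsInUc F Mc k α₀ α₁ a₀ ε₂₉ n B →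
      ∀ Y : (recordDomSys F Mc k (recordK₀ F Mc k + n)).Dom,
        ‖nonB0Block F k (recordK₀ F Mc k + n) (TY n Y (recordPairJ F (thetaFill F a₀ ε₂₉) k (recordK₀ F Mc k + n) B))‖ ≤
          c₀ * Real.exp (-(δ₀ * torusTreeLen (Y.1 : Finset (TPt (F.P (recordK₀ F Mc k + n)).d (Sect2.domCount (F.P (recordK₀ F Mc k + n)) Mc (k + 1)))))) := by
    intro n B hB Y
    have hag : Sect2.agreeOnSet (Sect2.domSites (F.P (recordK₀ F Mc k + n)) Mc (k + 1) Y)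
        (recordPairJ F (thetaFill F a₀ ε₂₉) k (recordK₀ F Mc k + n) B) (pairCutTorusAt F a₀ ε₂₉ Mc k (recordK₀ F Mc k + n) Y B) :=
      agreeOnSet_pairCutTorusAt a₀ ε₂₉ Mc k (recordK₀ F Mc k + n) Y B
    rw [hP4loc n Y (recordPairJ F (thetaFill F a₀ ε₂₉) k (recordK₀ F Mc k + n) B) (pairCutTorusAt F a₀ ε₂₉ Mc k (recordK₀ F Mc k + n) Y B) hag]
    exact hTYop n Y _ (hB Y)
  -- x-continuity of the resolvent pieces at a pair that cuts into the record space of `X`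
  have hcontCut : ∀ (n : ℕ) (B : recordW F a₀ ε₂₉ k (recordK₀ F Mc k + n)), CutsInUc F Mc k α₀ α₁ a₀ ε₂₉ n B →
      ∀ X : (recordDomSys F Mc k (recordK₀ F Mc k + n)).Dom,
        ContinuousOn (fun x : ℝ => EG x n X (recordPairJ F (thetaFill F a₀ ε₂₉) k (recordK₀ F Mc k + n) B)) (Set.Icc 0 R) := by
    intro n B hB X
    obtain ⟨O, hO, hOsub, hx, hcont⟩ := hg235 n X
    have hag : Sect2.agreeOnSet (Sect2.domSites (F.P (recordK₀ F Mc k + n)) Mc (k + 1) X)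
        (recordPairJ F (thetaFill F a₀ ε₂₉) k (recordK₀ F Mc k + n) B) (pairCutTorusAt F a₀ ε₂₉ Mc k (recordK₀ F Mc k + n) X B) :=
      agreeOnSet_pairCutTorusAt a₀ ε₂₉ Mc k (recordK₀ F Mc k + n) X B
    have hfun : (fun x : ℝ => EG x n X (recordPairJ F (thetaFill F a₀ ε₂₉) k (recordK₀ F Mc k + n) B)) =
        fun x : ℝ => EG x n X (pairCutTorusAt F a₀ ε₂₉ Mc k (recordK₀ F Mc k + n) X B) :=
      funext fun x => hg4 x n X _ _ hag
    rw [hfun]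
    exact (hcont _ (hOsub (hB X))).mono Set.Icc_subset_Ici_self
  -- the unit pair lies in every record space
  have hunit : ∀ (n : ℕ) (X : (recordDomSys F Mc k (recordK₀ F Mc k + n)).Dom),
      encodeCfg F (recordK₀ F Mc k + n) (unitCPair F (recordK₀ F Mc k + n)) ∈ recordUc F Mc k α₀ α₁ (recordK₀ F Mc k + n) X := by
    intro n X
    have h := encodeCfg_unitPair_mem_recordUc F Mc k (recordK₀ F Mc k + n) X hα₀ hα₁
    rwa [embedPair_unitPair] at h
  -- §1: the integer formula
  set unitZ : IntBondCfg := fun _ => (1, 0) with hunitZ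
  set ΨG : IntFormula := fun Xh f => (1 / 2 : ℂ) * (∫ x in (0 : ℝ)..R, EGZ x Xh f) + ΨP.Ψ Xh f with hΨG
  have hΨGloc : IntFormula.IsLocal (F.L ^ (k + 1) * Mc) ΨG := isLocal_lzdetGFormula EGZ ΨP hR.le fun x hx => (hgZ x hx).1
  have hΨGinv : IntFormula.IsGaugeInv ΨG := isGaugeInv_lzdetGFormula EGZ ΨP hR.le fun x hx => (hgZ x hx).2.1
  let Ψ : IntLocalFormula (F.L ^ (k + 1) * Mc) := ⟨fun Xh f => ΨG Xh f - ΨG Xh unitZ, isLocal_subUnit _ ΨG hΨGloc, isGaugeInv_subUnit ΨG hΨGinv⟩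
  -- the unsubtracted torus piece IS `ΨG` read through the cover, off the wrap class
  have hGpiece : ∀ (n : ℕ) (X : (recordDomSys F Mc k (recordK₀ F Mc k + n)).Dom), X ∉ recordWrapCtr F Mc k (recordK₀ F Mc k + n) →
      ∀ ψ, ΨG (intCubes F Mc k (recordK₀ F Mc k + n) X) (pullPair F (recordK₀ F Mc k + n) ψ) = lzdetGPiece F Mc k (recordK₀ F Mc k + n) (TY n) (fun x => EG x n) R X ψ := by
    intro n X hX ψ
    have hint : (∫ x in (0 : ℝ)..R, EGZ x (intCubes F Mc k (recordK₀ F Mc k + n) X) (pullPair F (recordK₀ F Mc k + n) ψ)) = ∫ x in (0 : ℝ)..R, EG x n X ψ :=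
      intervalIntegral.integral_congr fun x hx => by
        rw [Set.uIcc_of_le hR.le] at hx
        exact (hgZ x hx.1).2.2 n X hX ψ
    show (1 / 2 : ℂ) * (∫ x in (0 : ℝ)..R, EGZ x _ _) + ΨP.Ψ _ _ = _
    rw [hint]
    unfold lzdetGPiece
    congr 1
    exact hΨP n X hX ψ
  refine ⟨Ψ, lzdetTorusPieces F Mc k TY EG R, residueOnRegAtW_of_piecesJ F Mc k a₀ ε₂₉ α₀ α₁ ε₀ _ _ Ψ _ _ ?_ ?_ ?_ ?_ ?_ ?_⟩
  · -- off-wrap pieces = pull-back pieces of Ψ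
    intro n X hX φ
    show lzdetPiece F Mc k (recordK₀ F Mc k + n) (TY n) (fun x => EG x n) R X φ =
      ΨG (intCubes F Mc k (recordK₀ F Mc k + n) X) (pullPair F (recordK₀ F Mc k + n) φ) - ΨG (intCubes F Mc k (recordK₀ F Mc k + n) X) unitZ
    have hu : unitZ = pullPair F (recordK₀ F Mc k + n) (unitCPair F (recordK₀ F Mc k + n)) := rfl
    rw [hu, hGpiece n X hX, hGpiece n X hX]
    rfl
  · -- row (a)
    intro n X φ hφ
    obtain ⟨O, hO, hOsub, hx, hcont⟩ := hg235 n X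
    exact analyticAt_lzdetPiece F Mc k (recordK₀ F Mc k + n) (TY n) (fun x => EG x n) (fun s => cubeOfSite F Mc k (recordK₀ F Mc k + n) (blockOf s.1.1.src))
      hR hc₀ hδ hRc (hsupp n) X hO (fun ψ hψ => hOsub hψ) (fun x hx' => (hx x hx').1) (fun x hx' ψ hψ => (hx x hx').2 ψ hψ) hcont
      (fun Y ψ hψ => (hP4an n Y ψ hψ).1) (fun Y ψ hψ => (hP4an n Y ψ hψ).2.1) (fun Y ψ hψ => (hP4an n Y ψ hψ).2.2) φ hφ
  · -- row (b)
    intro n X φ hφ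
    obtain ⟨O, hO, hOsub, hx, hcont⟩ := hg235 n X
    have hmem : ∀ ψ ∈ ({φ, unitCPair F (recordK₀ F Mc k + n)} : Set (Sect2.CPair (F.P (recordK₀ F Mc k + n)) (MatA 2))),
        encodeCfg F (recordK₀ F Mc k + n) ψ ∈ recordUc F Mc k α₀ α₁ (recordK₀ F Mc k + n) X := by
      intro ψ hψ
      rcases hψ with rfl | hψ
      · exact hφ
      · rw [Set.mem_singleton_iff] at hψ; rw [hψ]; exact hunit n X
    have h := norm_lzdetPiece_le F Mc k (recordK₀ F Mc k + n) (TY n) (fun x => EG x n) (fun s => cubeOfSite F Mc k (recordK₀ F Mc k + n) (blockOf s.1.1.src))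
      hR hBc hc₀' hδ hRc₁ (hsupp n) (hV n) X φ
      (fun ψ hψ x hx' => (hx x hx'.1).2 ψ (hOsub (hmem ψ hψ)))
      (fun ψ hψ Y hY => hTYop n Y ψ (recordUc_anti F Mc k α₀ α₁ _ hY (hmem ψ hψ)))
    rw [neg_mul]
    exact h
  · -- row (c)
    intro n X φ ψ hag
    exact lzdetPiece_congr_of_agreeOnSet F Mc k (recordK₀ F Mc k + n) (TY n) (fun x => EG x n) R X (hP4loc n) (fun x φ' ψ' h => hg4 x n X φ' ψ' h) hag
  · -- row (d)
    intro n X u φ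
    obtain ⟨hU, hdiag, hcov⟩ := hP3 n u.1
    exact lzdetPiece_cAct F Mc k (recordK₀ F Mc k + n) (TY n) (fun x => EG x n) R X u.1 (AdM n u.1) hU hdiag hcov (fun x φ' => hg6 x n X u.1 φ') φ
  · -- the (63) identity AT EVERY CLASS POINT
    intro n B hB
    letI θ := thetaFill F a₀ ε₂₉; letI := θ.instVβ₁; letI := θ.instVβ₂; letI := θ.instιβ
    have h0 : InRegClass F Mc k ε₀ a₀ ε₂₉ n (0 : recordW F a₀ ε₂₉ k (recordK₀ F Mc k + n)) := inRegClass_zero F Mc k n ε₂₉ hε₀ ha₀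
    have hor : ∀ B' : recordW F a₀ ε₂₉ k (recordK₀ F Mc k + n), (B' = B ∨ B' = 0) → InRegClass F Mc k ε₀ a₀ ε₂₉ n B' := by
      rintro B' (rfl | rfl)
      · exact hB
      · exact h0
    exact phiLZdet_eq_sum_lzdetPiece_at F Mc a₀ ε₂₉ k n B (TC n) (TY n) (fun x => EG x n)
      (fun s => cubeOfSite F Mc k (recordK₀ F Mc k + n) (blockOf s.1.1.src)) hγ₁ hc₀' hδ hR₁ hRc₁
      (recordB0BlockInvertible_portVkAx_of_inRegClass F a₀ ε₂₉ Mc k n hε₀ hε₀c hε₀₁ (hTokE n) hB)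
      (fun B' hB' => hP2R n B' (hor B' hB'))
      (fun B' hB' => ⟨(hP5R n B' (hor B' hB')).1, fun v => ((hP5R n B' (hor B' hB')).2 v).2⟩)
      (hP4sum n) (hsupp n)
      (fun B' hB' => hTYopCut n B' (hNest n B' (hor B' hB')))
      (fun φ x hx => by rw [hg1pt n x hx φ]; rfl)
      (fun B' hB' => hcontCut n B' (hNest n B' (hor B' hB')))

end Summit.QuantumFields.YangMills.Theorems.BalabanUVNodesPortS1

end
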